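import Mathlib.Analysis.Complex.Basic
import Mathlib.Tactic.Ring
import Mathlib.Tactic.FieldSimp
import HarnessLib

/-!
# The value at the centre of `U(2,1)`, (A4-iii): the algebraic identity on the representative ray — jet order 1
# (ROAD A of crux H413; Rogawski 1990 §8.4 pp. 126–127, Harish-Chandra's limit formula `ω(ρ′ΔΦ_Θ) → c·Θ(γ₀)`)

Topic `Geometry/ComplexHyperbolic`; namespace `Literature.Geometry.ComplexHyperbolic.BallModel.CentreValueIdentity`.  THEOREMS ONLY (no `def`, no instance,
no notation, no axiom, no named fact, no `sorry`).  Cell `pub/hodgecm-mathlib`, ENGINE T1 (crux H413 = `stmt-HodgeConjecture-24833`); floor-1½, count-neutral, under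
«SdArch» ED. 3 node N1 = the (L_{U(2,1)}) letter ★ `ArchCentralLimitFormulaRankTwo` (`stub_ArchCentralLimitU21`); brick **(A4-iii)/W4** of the BLUEPRINT
`F0/P3a/F0P3a-p06/g12/BLUEPRINT-A4iii-ValueIdentity.F0P3a-p06g12.md` (1a66004584488fe3); MACHINE-GENERATED by `a4_lean_files.py` from the exact ℚ[i] certificate
(`a4_symbolic`, `a4_solve2`, `a4_primitive`); author F0P3a-p06 (g12), 2026-09-01.

WHAT THIS IS.  On the compact-adjacent chambers the corner value of the letter is `V = −(2i∕3)ψ″(0⁺) − (i∕2)ψ(0) + (1∕12)iχ″(0⁺)` (★ (A4)-I `ArchCentralLimitCompactWallOrbital`); with the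
ψ-jets of ★ `UnitBallKCentralWallCurveChain` (p05) and the χ-jets of ★ `UnitBallKCentralTransversalDatum` (A-p14, frame-free Casimir datum `Λ_χ`), `V = c_μ ∫_{ℂ²} k d⁴W` for an explicit density `k`.
The value theorem `∫ k = −i·σ(univ)·Θ(ζ•1)` (`σ(univ) = 4·vol{nsq<1} = 2π²`) is proved by splitting **`r³·k = ∂_r K + r³·(𝒟_A F_A + 𝒟_B F_B)`** along each ray (`K` the radial primitive with
`K(0⁺) = i·Θ(𝟙)`, ★ CORE `integral_eq_neg_smul_of_hasDerivAt_polar`; `𝒟_X F_X` flow-divergences of the su(2) pair, which integrate to zero).  THIS FILE is the purely ALGEBRAIC part of that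
identity at jet order 1 on the REPRESENTATIVE ray `W = (0, r)` (general `W` by transport `Θ ↦ Θ ∘ Ad κ_W`): it is stated over an ARBITRARY real vector space `E` with 18 distinguished vectors
(the natural directions `𝟙, i𝟙, P, iP, V₀, iV₀, V₀⁻, iV₀⁻, T, iT, Q⊥, iQ⊥, S⊥, iS⊥, Q⊥″, iQ⊥″, S⊥″, iS⊥″` of the blueprint — in the application the corresponding constant `3×3` complex matrices)
and an ARBITRARY real-multilinear symmetric `L1 : E^1 → ℂ` (in the application `D^1Θ(𝟙 + r²·iP)`); the composite directions (p05's `X₁, X₂`, A-p14's `E_kl·Π̃`-slots and their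
`t`-derivatives, the commutators `[X̃, ·]`) enter as variables with defining hypotheses, PRE-SCALED by `r^s·d` (`s, d ∈ ℕ`) so that no inverse powers occur, and every displayed equation is
multiplied by the common integer `D` recorded in the docstrings.  Per chunk of composite terms, a lemma expands the chunk into canonical atoms (multilinearity + symmetry + `ring`); the
`_flat` lemma is the resulting coefficient identity `Σ(density atoms) = Σ(∂_rK atoms) + Σ(angular atoms)`.  Nothing here depends on `Θ`, measures or matrices: soundness of the bookkeeping
is what Lean checks; that these composites ARE the integrands is the assembly's business (blueprint W6).
HONEST LABEL: HC_CM is proved only modulo the printed citations until rung 0 closes; this file is generated linear algebra and pays nothing by itself.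

## References
* [Rogawski1990] J. D. Rogawski, *Automorphic Representations of Unitary Groups in Three Variables*, Ann. of Math. Stud. 123 (1990), §8.4 pp. 126–127.
* [HormanderALPDO1] L. Hörmander, *The Analysis of Linear Partial Differential Operators I*, 2nd ed. (1990), §3.2–§3.3 (Euler's identity; the vertex term of radial integration by parts).
-/

set_option linter.unusedVariables false
set_option linter.unusedSimpArgs false
set_option linter.unusedTactic false

namespace Literature.Geometry.ComplexHyperbolic.BallModel.CentreValueIdentity

set_option maxHeartbeats 1000000 in
/-- **(A4-iii), jet order 1, DENSITY side (`D·r³·k`, the ψ- and χ-jet terms), chunk 0** (all sides × `D = 12`): the displayed composite terms expand, by real multilinearity and symmetry of `L1`, into the displayed canonical atom sum (blueprint W4; generated). [cite: Rogawski1990, §8.4 pp. 126–127] -/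
theorem centreValue_rep_order1_k_chunk0
    {E : Type*} [AddCommGroup E] [Module ℝ E]
    (n1 ni1 nP iP nV0 niV0 nVm niVm nT niT nQp niQp nSp niSp nQpp niQpp nSpp niSpp : E)
    (L1 : E → ℂ)
    (hL1add0 : ∀ (a b : E) , L1  (a + b)  = L1  a  + L1  b )
    (hL1smul0 : ∀ (c : ℝ) (a : E) , L1  (c • a)  = (c : ℂ) * L1  a )
    (r : ℝ)
    (X2 : E) (hX2 : X2 = ((-1 : ℝ) * r ^ 4) • iP + ((-4 : ℝ) * r ^ 2) • n1 + ((6 : ℝ) * r ^ 2) • nV0 + (18 : ℝ) • niT + (-9 : ℝ) • niV0)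
    (pi_1 : E) (hpi_1 : pi_1 = ((2 : ℝ) * r ^ 2) • iP + (6 : ℝ) • n1 + (3 : ℝ) • nV0)
    :
    (((-2 : ℂ) * Complex.I) * (r : ℂ) ^ 1 * (L1 X2) + ((-3 : ℂ) * Complex.I) * (r : ℂ) ^ 3 * (L1 pi_1)) =
    ((((-4 : ℂ) * Complex.I) * (r : ℂ) ^ 5) * (L1 iP) + (((-10 : ℂ) * Complex.I) * (r : ℂ) ^ 3) * (L1 n1) + (((-21 : ℂ) * Complex.I) * (r : ℂ) ^ 3) * (L1 nV0) +
          (((-36 : ℂ) * Complex.I) * (r : ℂ) ^ 1) * (L1 niT) + (((18 : ℂ) * Complex.I) * (r : ℂ) ^ 1) * (L1 niV0)) := by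
  subst hX2 hpi_1
  try simp only [hL1add0, hL1smul0]
  push_cast
  ring

set_option maxHeartbeats 1000000 in
/-- **(A4-iii), jet order 1, RADIAL side (`D·∂_rK`, the derivative of the radial primitive), chunk 0** (all sides × `D = 12`): the displayed composite terms expand, by real multilinearity and symmetry of `L1`, into the displayed canonical atom sum (blueprint W4; generated). [cite: Rogawski1990, §8.4 pp. 126–127] -/
theorem centreValue_rep_order1_Kp_chunk0
    {E : Type*} [AddCommGroup E] [Module ℝ E]
    (n1 ni1 nP iP nV0 niV0 nVm niVm nT niT nQp niQp nSp niSp nQpp niQpp nSpp niSpp : E)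
    (L1 : E → ℂ)
    (hL1add0 : ∀ (a b : E) , L1  (a + b)  = L1  a  + L1  b )
    (hL1smul0 : ∀ (c : ℝ) (a : E) , L1  (c • a)  = (c : ℂ) * L1  a )
    (r : ℝ)
    :
    (((24 : ℂ) * Complex.I) * (r : ℂ) ^ 1 * (L1 iP) + ((10 : ℂ) * Complex.I) * (r : ℂ) ^ 3 * (L1 n1) + ((-40 : ℂ) * Complex.I) * (r : ℂ) ^ 3 * (L1 nP) +
          ((9 : ℂ) * Complex.I) * (r : ℂ) ^ 3 * (L1 nV0) + ((-1 : ℂ) * Complex.I) * (r : ℂ) ^ 5 * (L1 iP) + ((-3 : ℂ) * Complex.I) * (r : ℂ) ^ 5 * (L1 iP)) =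
    ((((24 : ℂ) * Complex.I) * (r : ℂ) ^ 1 + ((-4 : ℂ) * Complex.I) * (r : ℂ) ^ 5) * (L1 iP) + (((10 : ℂ) * Complex.I) * (r : ℂ) ^ 3) * (L1 n1) +
          (((-40 : ℂ) * Complex.I) * (r : ℂ) ^ 3) * (L1 nP) + (((9 : ℂ) * Complex.I) * (r : ℂ) ^ 3) * (L1 nV0)) := by
  try simp only [hL1add0, hL1smul0]
  push_cast
  ring

set_option maxHeartbeats 1000000 in
/-- **(A4-iii), jet order 1, RADIAL side (`D·∂_rK`, the derivative of the radial primitive), chunk 1** (all sides × `D = 12`): the displayed composite terms expand, by real multilinearity and symmetry of `L1`, into the displayed canonical atom sum (blueprint W4; generated). [cite: Rogawski1990, §8.4 pp. 126–127] -/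
theorem centreValue_rep_order1_Kp_chunk1
    {E : Type*} [AddCommGroup E] [Module ℝ E]
    (n1 ni1 nP iP nV0 niV0 nVm niVm nT niT nQp niQp nSp niSp nQpp niQpp nSpp niSpp : E)
    (L1 : E → ℂ)
    (hL1add0 : ∀ (a b : E) , L1  (a + b)  = L1  a  + L1  b )
    (hL1smul0 : ∀ (c : ℝ) (a : E) , L1  (c • a)  = (c : ℂ) * L1  a )
    (r : ℝ)
    :
    (((-24 : ℂ) * Complex.I) * (r : ℂ) ^ 1 * (L1 niV0) + ((8 : ℂ) * Complex.I) * (r : ℂ) ^ 1 * (L1 iP) + ((-16 : ℂ) * Complex.I) * (r : ℂ) ^ 1 * (L1 ni1)) =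
    ((((8 : ℂ) * Complex.I) * (r : ℂ) ^ 1) * (L1 iP) + (((-16 : ℂ) * Complex.I) * (r : ℂ) ^ 1) * (L1 ni1) + (((-24 : ℂ) * Complex.I) * (r : ℂ) ^ 1) * (L1 niV0)) := by
  try simp only [hL1add0, hL1smul0]
  push_cast
  ring

set_option maxHeartbeats 1000000 in
/-- **(A4-iii), jet order 1, ANGULAR side (`D·r³·(𝒟_A F_A +
      𝒟_B F_B)`), chunk 0** (all sides × `D = 12`): the displayed composite terms expand, by real multilinearity and symmetry of `L1`, into the displayed canonical atom sum (blueprint W4; generated). [cite: Rogawski1990, §8.4 pp. 126–127] -/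
theorem centreValue_rep_order1_ang_chunk0
    {E : Type*} [AddCommGroup E] [Module ℝ E]
    (n1 ni1 nP iP nV0 niV0 nVm niVm nT niT nQp niQp nSp niSp nQpp niQpp nSpp niSpp : E)
    (L1 : E → ℂ)
    (hL1add0 : ∀ (a b : E) , L1  (a + b)  = L1  a  + L1  b )
    (hL1smul0 : ∀ (c : ℝ) (a : E) , L1  (c • a)  = (c : ℂ) * L1  a )
    (r : ℝ)
    (cA_Qp : E) (hcA_Qp : cA_Qp = (2 : ℝ) • n1 + (-4 : ℝ) • nP + (3 : ℝ) • nV0)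
    (cA_iSp : E) (hcA_iSp : cA_iSp = (-4 : ℝ) • iP + (2 : ℝ) • ni1 + (-2 : ℝ) • niT + (4 : ℝ) • niV0)
    (cA_iQp : E) (hcA_iQp : cA_iQp = (-4 : ℝ) • iP + (2 : ℝ) • ni1 + (3 : ℝ) • niV0)
    (cB_iSpp : E) (hcB_iSpp : cB_iSpp = (4 : ℝ) • iP + (-2 : ℝ) • ni1 + (2 : ℝ) • niT + (-4 : ℝ) • niV0)
    (cB_iQpp : E) (hcB_iQpp : cB_iQpp = (4 : ℝ) • iP + (-2 : ℝ) • ni1 + (-3 : ℝ) • niV0)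
    (cB_Qpp : E) (hcB_Qpp : cB_Qpp = (-2 : ℝ) • n1 + (4 : ℝ) • nP + (-3 : ℝ) • nV0)
    :
    (((-5 : ℂ) * Complex.I) * (r : ℂ) ^ 3 * (L1 cA_Qp) + ((9 : ℂ) * Complex.I) * (r : ℂ) ^ 1 * (L1 cA_iSp) + ((-5 : ℂ) * Complex.I) * (r : ℂ) ^ 1 * (L1 cA_iQp) +
          ((-9 : ℂ) * Complex.I) * (r : ℂ) ^ 1 * (L1 cB_iSpp) + ((5 : ℂ) * Complex.I) * (r : ℂ) ^ 1 * (L1 cB_iQpp) + ((5 : ℂ) * Complex.I) * (r : ℂ) ^ 3 * (L1 cB_Qpp)) =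
    ((((-32 : ℂ) * Complex.I) * (r : ℂ) ^ 1) * (L1 iP) + (((-20 : ℂ) * Complex.I) * (r : ℂ) ^ 3) * (L1 n1) + (((40 : ℂ) * Complex.I) * (r : ℂ) ^ 3) * (L1 nP) +
          (((-30 : ℂ) * Complex.I) * (r : ℂ) ^ 3) * (L1 nV0) + (((16 : ℂ) * Complex.I) * (r : ℂ) ^ 1) * (L1 ni1) + (((-36 : ℂ) * Complex.I) * (r : ℂ) ^ 1) * (L1 niT) +
          (((42 : ℂ) * Complex.I) * (r : ℂ) ^ 1) * (L1 niV0)) := by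
  subst hcA_Qp hcA_iSp hcA_iQp hcB_iSpp hcB_iQpp hcB_Qpp
  try simp only [hL1add0, hL1smul0]
  push_cast
  ring

/-- **(A4-iii), jet order 1, FLAT COEFFICIENT IDENTITY** (× `D = 12`): the canonical atoms of `D·r³·k` equal those of `D·∂_rK` plus those of the angular part — the order-1 component of `r³·k = ∂_rK +
      r³·(𝒟_A F_A + 𝒟_B F_B)` on the representative ray (blueprint W4; generated). [cite: Rogawski1990, §8.4 pp. 126–127] [cite: HormanderALPDO1, §3.2 (3.2.19)′] -/
theorem centreValue_rep_order1_flat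
    {E : Type*} [AddCommGroup E] [Module ℝ E]
    (n1 ni1 nP iP nV0 niV0 nVm niVm nT niT nQp niQp nSp niSp nQpp niQpp nSpp niSpp : E)
    (L1 : E → ℂ)
    (hL1add0 : ∀ (a b : E) , L1  (a + b)  = L1  a  + L1  b )
    (hL1smul0 : ∀ (c : ℝ) (a : E) , L1  (c • a)  = (c : ℂ) * L1  a )
    (r : ℝ)
    :
    ((((-4 : ℂ) * Complex.I) * (r : ℂ) ^ 5) * (L1 iP) + (((-10 : ℂ) * Complex.I) * (r : ℂ) ^ 3) * (L1 n1) + (((-21 : ℂ) * Complex.I) * (r : ℂ) ^ 3) * (L1 nV0) +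
          (((-36 : ℂ) * Complex.I) * (r : ℂ) ^ 1) * (L1 niT) + (((18 : ℂ) * Complex.I) * (r : ℂ) ^ 1) * (L1 niV0)) =
    ((((32 : ℂ) * Complex.I) * (r : ℂ) ^ 1 + ((-4 : ℂ) * Complex.I) * (r : ℂ) ^ 5) * (L1 iP) + (((10 : ℂ) * Complex.I) * (r : ℂ) ^ 3) * (L1 n1) +
          (((-40 : ℂ) * Complex.I) * (r : ℂ) ^ 3) * (L1 nP) + (((9 : ℂ) * Complex.I) * (r : ℂ) ^ 3) * (L1 nV0) + (((-16 : ℂ) * Complex.I) * (r : ℂ) ^ 1) * (L1 ni1) +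
          (((-24 : ℂ) * Complex.I) * (r : ℂ) ^ 1) * (L1 niV0)) +
    ((((-32 : ℂ) * Complex.I) * (r : ℂ) ^ 1) * (L1 iP) + (((-20 : ℂ) * Complex.I) * (r : ℂ) ^ 3) * (L1 n1) + (((40 : ℂ) * Complex.I) * (r : ℂ) ^ 3) * (L1 nP) +
          (((-30 : ℂ) * Complex.I) * (r : ℂ) ^ 3) * (L1 nV0) + (((16 : ℂ) * Complex.I) * (r : ℂ) ^ 1) * (L1 ni1) + (((-36 : ℂ) * Complex.I) * (r : ℂ) ^ 1) * (L1 niT) +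
          (((42 : ℂ) * Complex.I) * (r : ℂ) ^ 1) * (L1 niV0)) := by
  ring

end Literature.Geometry.ComplexHyperbolic.BallModel.CentreValueIdentity
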